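import Summits.CriticalPhenomena.CardyFormulaZ2.Theorems.CardyComplexConeParafermionToSLESixFamiliesIicTouchLawPin
import Summits.CriticalPhenomena.CardyFormulaZ2.Theorems.CardyComplexConeParafermionToSLESixFamiliesIicRectilinear
import Literature.Analysis.Complex.StripPositivityRigidityWeak
import HarnessLib.Audit

/-!
# Skeleton r1 (lead c2 copy) of line `iic-trace-flux-pairing` — crux `ParafermionToSLESixFamilies`
(stmt-CriticalPhenomena-11389, route `CardyComplexCone`, sub-problem `CriticalPhenomena/CardyFormulaZ2`)

This is the registered skeleton r1 (lead 0 reshape f9b3d166, re-owned by lead c1 as 59632804, re-owned here by lead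
c2) written over the LANDED vocabulary modules of the line instead of a private copy:

* `…IicDefs` — the three crux blocks `WeakHolFamilies` (A), `PrecompactFamilies` (B), `SLESixAllFamilies` (C),
  `IsFamily`, `iface`, `perc`, `SLESixAlong`, `slesixAllFamilies_iff`, `stagger`, `StaggeredVanishingFamilies`,
  `HalfPlaneOneArmLower`, `StripRigidityWeak`, the touch vocabulary, `TouchLawPos`, `IsRectilinear`,
  `TightOnRectilinear`, `IdentOnRectilinear`;
* `…IicTight` — `tightOnRectilinear` (PROVED, Aizenman–Burchard for arbitrary admissible families);
* `…IicTouchLawPin` — `TouchLawPosPin` (the slit-uniform pinned touch law of the S6 audit);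
* `…IicRectilinear` — `slesixAlong_of_ident` (identification ⇒ SLE₆ along one family, PROVED);
* `Literature.Analysis.Complex.strip_rigidity_of_nonneg_weak_boundary_values` — S4, PROVED (p98965).

Seven registered stubs (ledger `skeleton.stubs`): `stub_uniformInnerEnvelope` (S1), `stub_halfPlaneOneArmLower` (S2),
`stub_staggeredModeBound` (S3), `stub_touchLawOfPairing` (S5), `stub_touchLawPin` (S6a), `stub_identOnRectilinear`
(S6b), `stub_allDomainsOfRectilinear` (S7); `stub_stripRigidity` (S4) is kept as a sorry-free skeleton theorem.
`ParafermionToSLESixFamilies_of` concludes the route declaration BY NAME; its `sorryAx` dependence sits entirely in the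
seven `stub_*` declarations.

STATUS (lead c2, 2026-08-16): S1, S2, S3 are acknowledged OPEN inputs of conjecture strength for bond percolation on
`ℤ²` (sharp `δ^{1/3}` envelope; half-plane one-arm lower bound `π₁⁺(n) ≥ c n^{-1/3}`, rigorous only `≥ c n^{-1/2}`;
vanishing of the staggered corner mode) — see `Lines/iic-trace-flux-pairing.dead.md` and the crux's `Disproof.lean` §4–§5
(`crux_iff_conjecture_of_not_nonDegenerate`, `oneSided_even_with_nonDegeneracy`).
-/

noncomputable section

namespace Summit.CriticalPhenomena.CardyFormulaZ2.Cruxes.ParafermionToSLESixFamilies.IicTraceFluxPairing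

open scoped Topology NNReal ENNReal
open Filter MeasureTheory Set Metric
open Literature.Probability.LatticeModels Literature.Probability.Percolation
open Literature.Probability.RandomPlanarGeometry
open Summit.CriticalPhenomena.CardyFormulaZ2.Theses.CardyComplexCone (ParafermionToSLESixFamilies)
open Summit.CriticalPhenomena.CardyFormulaZ2.Cruxes.EdgePrecompact.QkzStripBoundaryArm (UniformInnerEnvelope)

/-! ## §1 The crux is literally `A → B → C` -/

/-- The route declaration unfolds, definitionally, to `WeakHolFamilies → PrecompactFamilies → SLESixAllFamilies`. -/
theorem crux_iff : ParafermionToSLESixFamilies ↔ (WeakHolFamilies → PrecompactFamilies → SLESixAllFamilies) :=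
  Iff.rfl

/-! ## §2 The registered stubs -/

/-- **S1** (OPEN; shared with cruxes 11387 / 10814): the uniform inner envelope `‖cornerObs E E.δ v f‖ ≤ C R^{-1/3}`
at lattice depth `R`, one constant for all Jordan Dobrushin domains and all admissible data. -/
theorem stub_uniformInnerEnvelope : UniformInnerEnvelope := by
  sorry

/-- **S2** (OPEN): the axis half-plane one-arm lower bound `π₁⁺(n) ≥ c n^{-1/3}` eventually, bond-`ℤ²` at `p = 1/2`.
Rigorous today: `π₁⁺(n) ≥ c n^{-1/2}` (BK + universal half-plane two-arm exponent); the `n^{-1/3}` form is the sharp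
lower bound of the conjectured exponent `β₁⁺ = 1/3` and is the up-to-constants strengthening of crux 5662
`HalfPlaneOneArmThird` (log form, itself only conditionally proved in the tree). -/
theorem stub_halfPlaneOneArmLower : HalfPlaneOneArmLower := by
  sorry

/-- **S3** (OPEN): vanishing of the staggered corner mode `G(NW) − G(NE) + G(SE) − G(SW) = o(δ^{1/3})` on compacts
along every family — upstream class-coherence information (route items EdgeCoherence ∧ EdgePrecompact with the conformal
character) that the crux's interface `A ∧ B` discards. -/
theorem stub_staggeredModeBound : StaggeredVanishingFamilies := by
  sorry

/-- **S4** (CLOSED): strip rigidity with non-negative weak boundary values on both lines — the Literature theorem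
`Literature.Analysis.Complex.strip_rigidity_of_nonneg_weak_boundary_values` (p98965) has literally this statement. -/
theorem stub_stripRigidity : StripRigidityWeak :=
  Literature.Analysis.Complex.strip_rigidity_of_nonneg_weak_boundary_values

/-- **S5** (XL, the engine): boundary-first normalisation + exact flux pairing + positivity rigidity ⇒ the positive
touch law on rectilinear polygons. Consumes S1 (weak-* compactness, collar, growth), S2 (amplitude `c > 0`), S3
(no staggered mode in the limit), S4 (rigidity). -/
theorem stub_touchLawOfPairing :
    WeakHolFamilies → PrecompactFamilies → UniformInnerEnvelope → HalfPlaneOneArmLower →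
      StaggeredVanishingFamilies → StripRigidityWeak →
      ∀ D : DobrushinDomain, IsRectilinear D → TouchLawPos D := by
  sorry

/-- **S6a** (research: slit uniformity U): the positive touch law for admissible families of rectilinear polygons ⇒
its slit-uniform pinned form `TouchLawPosPin` (one subsequence and one amplitude serving every exploration prefix). -/
theorem stub_touchLawPin :
    (∀ D : DobrushinDomain, IsRectilinear D → TouchLawPos D) →
      ∀ D : DobrushinDomain, IsRectilinear D → TouchLawPosPin D := by
  sorry

/-- **S6b** (XL): the slit-uniform pinned touch law ⇒ identification of every subsequential interface law on rectilinear
polygons as chordal SLE₆ (Doob martingales of the pinned touch functionals — landed —, Loewner describability of the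
non-simple medial interface, transport of the window density, `κ = 6` far-field detector, Lévy). -/
theorem stub_identOnRectilinear :
    (∀ D : DobrushinDomain, IsRectilinear D → TouchLawPosPin D) → IdentOnRectilinear := by
  sorry

/-- **S7** (XL): SLE₆ along every admissible family of every rectilinear polygon ⇒ block C (all Jordan domains, all
families): rectilinear Cardy ⇒ Cardy (proved sandwich) ⇒ Camia–Newman identification on all domains (absent for
bond-`ℤ²`); reduction `allDomainsOfRectilinear_of` landed. -/
theorem stub_allDomainsOfRectilinear :
    (∀ D : DobrushinDomain, IsRectilinear D → ∀ Λ : ℝ → DiscreteDobrushin, IsFamily D Λ → SLESixAlong D Λ) →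
      SLESixAllFamilies := by
  sorry

/-! ## §3 Composition (sorry-free outside the stubs) -/

/-- Identification on rectilinear polygons ⇒ SLE₆ along every admissible family of every rectilinear polygon
(tightness and measurability are unconditional: `slesixAlong_of_ident`). -/
theorem slesixAlong_rectilinear_of_ident (hI : IdentOnRectilinear) :
    ∀ D : DobrushinDomain, IsRectilinear D → ∀ Λ : ℝ → DiscreteDobrushin, IsFamily D Λ → SLESixAlong D Λ :=
  fun D hD Λ hΛ => slesixAlong_of_ident D Λ hΛ (hI D hD Λ hΛ)

/-- **Arrow-form composition** `A → B → S1 → S2 → S3 → S4 → (S5) → (S6a) → (S6b) → (S7) → C`. -/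
theorem slesixAllFamilies_of_stubs
    (h₁ : UniformInnerEnvelope) (h₂ : HalfPlaneOneArmLower) (h₃ : StaggeredVanishingFamilies)
    (h₄ : StripRigidityWeak)
    (h₅ : WeakHolFamilies → PrecompactFamilies → UniformInnerEnvelope → HalfPlaneOneArmLower →
      StaggeredVanishingFamilies → StripRigidityWeak → ∀ D : DobrushinDomain, IsRectilinear D → TouchLawPos D)
    (h₆ : (∀ D : DobrushinDomain, IsRectilinear D → TouchLawPos D) →
      ∀ D : DobrushinDomain, IsRectilinear D → TouchLawPosPin D)
    (h₆' : (∀ D : DobrushinDomain, IsRectilinear D → TouchLawPosPin D) → IdentOnRectilinear)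
    (h₇ : (∀ D : DobrushinDomain, IsRectilinear D → ∀ Λ : ℝ → DiscreteDobrushin, IsFamily D Λ → SLESixAlong D Λ) →
      SLESixAllFamilies) :
    WeakHolFamilies → PrecompactFamilies → SLESixAllFamilies := fun hA hB =>
  h₇ (slesixAlong_rectilinear_of_ident (h₆' (h₆ (h₅ hA hB h₁ h₂ h₃ h₄))))

/-- **The skeleton theorem**: the registered stubs prove the crux `CardyComplexCone.ParafermionToSLESixFamilies`
BY NAME (its `sorryAx` dependence sits entirely inside the `stub_*` declarations). -/
theorem ParafermionToSLESixFamilies_of : ParafermionToSLESixFamilies :=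
  crux_iff.2 (slesixAllFamilies_of_stubs stub_uniformInnerEnvelope stub_halfPlaneOneArmLower stub_staggeredModeBound
    stub_stripRigidity stub_touchLawOfPairing stub_touchLawPin stub_identOnRectilinear stub_allDomainsOfRectilinear)

end Summit.CriticalPhenomena.CardyFormulaZ2.Cruxes.ParafermionToSLESixFamilies.IicTraceFluxPairing

end
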